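import Mathlib
import Summits.Ventures.PercRepro2.Defs
import Summits.Ventures.PercRepro2.Graph
import Summits.Ventures.PercRepro2.Events
import Summits.Ventures.PercRepro2.Harris
import Summits.Ventures.PercRepro2.PinnedLaw
import Summits.Ventures.PercRepro2.XWForm
import Summits.Ventures.PercRepro2.XWKFiveTab
import Summits.Ventures.PercRepro2.XWKFiveSub
import Summits.Ventures.PercRepro2.XWRelabel
import Summits.Ventures.PercRepro2.XWKFiveDec01
import Summits.Ventures.PercRepro2.XWKFiveDec02
import Summits.Ventures.PercRepro2.XWKFiveDec03
import Summits.Ventures.PercRepro2.XWKFiveDec04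
import Summits.Ventures.PercRepro2.XWKFiveDec05
import Summits.Ventures.PercRepro2.XWKFiveDec06
import Summits.Ventures.PercRepro2.XWKFiveDec07
import Summits.Ventures.PercRepro2.XWKFiveDec08
import Summits.Ventures.PercRepro2.XWKFiveDec09
import Summits.Ventures.PercRepro2.XWKFiveDec10
import Summits.Ventures.PercRepro2.XWKFiveDec11
import Summits.Ventures.PercRepro2.XWKFiveDec12
import Summits.Ventures.PercRepro2.XWKFiveDec13
import Summits.Ventures.PercRepro2.XWKFiveDec14
import Summits.Ventures.PercRepro2.XWKFiveDec15
import Summits.Ventures.PercRepro2.XWKFiveDec16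

/-!
# (XW) on the complete graph `K₅` for every weight vector and every placement of four distinct
marks (PercRepro2, p2 g24)

**`xw_k5`**: `0 ≤ xwBil k5 s y o u p p` for every admissible weight vector on the ten edges of
`K₅` and every placement of four distinct marks — hence (XW) on every loop-free multigraph on
five vertices (an absent edge is weight `0`, a parallel class one edge of weight
`1 − ∏(1 − pᵢ)`).  This is the full reach of the pin-induction certificate of the (XW) line:
the coefficientwise statement fails at six vertices (P2-G24-XWGEN.md §8).

Assembly: the sixteen decided slices `XWKFiveDec01–16` (the `3^10 = 59,049` minors of `K₅` and
their `4^10` colouring pairs at the placement `0, 1, 2, 3`) give `sums_all`, hence every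
antipodal coefficient at that placement (`XWKFiveSub.xwAntiZ_nonneg_of_sums`), hence (XW) there
by `xw_of_xwbern` through the bridges at point masses (`xw_k5_base`, as in `XWKFour.lean`); the
`S₅` relabelling `xwBil_relabel` (`XWRelabel.lean`) along the vertex map `permOf s y o u` and its
edge permutation `sigmaOf` (the kernel decides bijectivity and compatibility with `k5` for all
`120` placements) spreads it to every placement.  Own work; standard axioms.
-/

namespace Summit.Ventures.PercRepro2

namespace XWKFive

/-! ## The sixteen slices assembled -/

/-- **The decided sums, all masks**: the sixteen slices. -/
theorem sums_all : ∀ m < 1024, ∀ k < 1024, k &&& m = 0 → negSum k m ≤ posSum k m := by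
  intro m hm k hk hkm
  by_cases h01 : m < 64
  · exact sums_slice01 m (by omega) h01 k hk hkm
  by_cases h02 : m < 128
  · exact sums_slice02 m (by omega) h02 k hk hkm
  by_cases h03 : m < 192
  · exact sums_slice03 m (by omega) h03 k hk hkm
  by_cases h04 : m < 256
  · exact sums_slice04 m (by omega) h04 k hk hkm
  by_cases h05 : m < 320
  · exact sums_slice05 m (by omega) h05 k hk hkm
  by_cases h06 : m < 384
  · exact sums_slice06 m (by omega) h06 k hk hkm
  by_cases h07 : m < 448
  · exact sums_slice07 m (by omega) h07 k hk hkm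
  by_cases h08 : m < 512
  · exact sums_slice08 m (by omega) h08 k hk hkm
  by_cases h09 : m < 576
  · exact sums_slice09 m (by omega) h09 k hk hkm
  by_cases h10 : m < 640
  · exact sums_slice10 m (by omega) h10 k hk hkm
  by_cases h11 : m < 704
  · exact sums_slice11 m (by omega) h11 k hk hkm
  by_cases h12 : m < 768
  · exact sums_slice12 m (by omega) h12 k hk hkm
  by_cases h13 : m < 832
  · exact sums_slice13 m (by omega) h13 k hk hkm
  by_cases h14 : m < 896
  · exact sums_slice14 m (by omega) h14 k hk hkm
  by_cases h15 : m < 960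
  · exact sums_slice15 m (by omega) h15 k hk hkm
  exact sums_slice16 m (by omega) hm k hk hkm

/-! ## Bridges from the ring-valued forms to the integer forms -/

section Bridge

variable {R : Type*} [CommRing R] [Nontrivial R]

/-- The probability of an event under a pinned weight vector is the indicator of the forced
configuration, written through a Boolean. -/
lemma prob_pinned_eq_indZ {p : Fin 10 → R} (hp : Pinned.IsPinned p) (A : Set (Config (Fin 10)))
    (b : Bool) (hb : Pinned.pinnedConfig p ∈ A ↔ b = true) :
    prob p A = ((indZ b : ℤ) : R) := by
  classical
  rw [Pinned.prob_eq_indicator_of_pinned hp, Set.indicator_apply]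
  cases b
  · rw [if_neg (fun h => by simpa using hb.1 h)]
    simp [indZ]
  · rw [if_pos (hb.2 rfl)]
    simp [indZ]

/-- Membership in an intersection of two connection events, as a Boolean. -/
lemma mem_inter2_iff (ω : Config (Fin 10)) (a b c d : Fin 5) :
    ω ∈ connEvent k5 a b ∩ connEvent k5 c d ↔ (connB ω a b && connB ω c d) = true := by
  simp only [Set.mem_inter_iff, mem_connEvent_iff, Bool.and_eq_true]

/-- Membership in an intersection of three connection events, as a Boolean. -/
lemma mem_inter3_iff (ω : Config (Fin 10)) (a b c d e f : Fin 5) :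
    ω ∈ connEvent k5 a b ∩ connEvent k5 c d ∩ connEvent k5 e f ↔
      (connB ω a b && connB ω c d && connB ω e f) = true := by
  simp only [Set.mem_inter_iff, mem_connEvent_iff, Bool.and_eq_true]

/-- **`B_W` at two pinned weight vectors is the integer form at the forced configurations.** -/
lemma xwBil_pinned_eq {p q : Fin 10 → R} (hp : Pinned.IsPinned p) (hq : Pinned.IsPinned q)
    (s y o u : Fin 5) :
    xwBil k5 s y o u p q =
      ((xwZ s y o u (Pinned.pinnedConfig p) (Pinned.pinnedConfig q) : ℤ) : R) := by
  unfold xwBil xwZ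
  rw [prob_pinned_eq_indZ hp _ _ (mem_inter2_iff _ s u y o),
    prob_pinned_eq_indZ hp _ _ (mem_inter2_iff _ s y s u),
    prob_pinned_eq_indZ hq _ _ (mem_inter2_iff _ s y y o),
    prob_pinned_eq_indZ hp _ _ (mem_connEvent_iff _ s u),
    prob_pinned_eq_indZ hq _ _ (mem_connEvent_iff _ y o),
    prob_pinned_eq_indZ hp _ _ (mem_connEvent_iff _ s y),
    prob_pinned_eq_indZ hq _ _ (mem_inter3_iff _ s y s u y o)]
  push_cast
  ring

/-- Pinning on `F` keeps a pinned vector pinned. -/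
lemma isPinned_pinOn {p : Fin 10 → R} (hp : Pinned.IsPinned p) (F : Finset (Fin 10))
    (η : Config (Fin 10)) : Pinned.IsPinned (pinOn p F η) := by
  intro e
  by_cases he : e ∈ F
  · cases η e <;> simp [pinOn, he]
  · simp only [pinOn, he, if_false]
    exact hp e

/-- The forced configuration of `pinOn p F η` is `pinnedConfig p` overwritten by `η` on `F`. -/
lemma pinnedConfig_pinOn {p : Fin 10 → R} (F : Finset (Fin 10)) (η : Config (Fin 10)) :
    Pinned.pinnedConfig (pinOn p F η) = mix (Pinned.pinnedConfig p) F η := by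
  funext e
  by_cases he : e ∈ F
  · cases hη : η e <;> simp [Pinned.pinnedConfig, pinOn, mix, he, hη]
  · simp [Pinned.pinnedConfig, pinOn, mix, he]

end Bridge

section BridgeOrdered

variable {R : Type*} [CommRing R] [LinearOrder R] [IsStrictOrderedRing R]

/-- **The antipodal coefficient at a pinned weight vector is the integer antipodal sum.** -/
lemma xwAnti_pinned_eq {p : Fin 10 → R} (hp : Pinned.IsPinned p) (s y o u : Fin 5)
    (F : Finset (Fin 10)) :
    xwAnti k5 s y o u p F = ((xwAntiZ s y o u (Pinned.pinnedConfig p) F : ℤ) : R) := by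
  unfold xwAnti xwAntiZ
  push_cast
  refine Finset.sum_congr rfl fun η _ => ?_
  rw [xwBil_pinned_eq (isPinned_pinOn hp F η) (isPinned_pinOn hp F _), pinnedConfig_pinOn,
    pinnedConfig_pinOn]

/-- **(XW) on `K₅` at the placement `0, 1, 2, 3`** (the sixteen decided slices through the pin
induction `xw_of_xwbern`). -/
theorem xw_k5_base (p : Fin 10 → R) (hp : IsProbVec p) : 0 ≤ xwBil k5 0 1 2 3 p p := by
  refine xw_of_xwbern k5 0 1 2 3 ?_ p hp
  intro q _ hpin F
  rw [xwAnti_pinned_eq hpin]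
  exact_mod_cast xwAntiZ_nonneg_of_sums sums_all (Pinned.pinnedConfig q) F

end BridgeOrdered

/-! ## Every placement by the `S₅` relabelling -/

/-- The vertex map sending `0, 1, 2, 3` to the marks and `4` to the remaining vertex. -/
def permOf (s y o u : Fin 5) : Fin 5 → Fin 5 :=
  ![s, y, o, u, ⟨(10 - (s.val + y.val + o.val + u.val)) % 5, Nat.mod_lt _ (by norm_num)⟩]

/-- The first endpoint of each edge of `K₅`. -/
def ea : Fin 10 → Fin 5 := ![0, 0, 0, 0, 1, 1, 1, 2, 2, 3]

/-- The second endpoint of each edge of `K₅`. -/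
def eb : Fin 10 → Fin 5 := ![1, 2, 3, 4, 2, 3, 4, 3, 4, 4]

/-- The edge permutation induced by a vertex map. -/
def sigmaOf (φ : Fin 5 → Fin 5) : Fin 10 → Fin 10 :=
  fun e => ⟨edgeIdx (φ (ea e)) (φ (eb e)) % 10, Nat.mod_lt _ (by norm_num)⟩

/-- For four distinct marks the vertex map is a bijection. -/
lemma permOf_bij : ∀ s y o u : Fin 5, s ≠ y → s ≠ o → s ≠ u → y ≠ o → y ≠ u → o ≠ u →
    Function.Bijective (permOf s y o u) := by
  decide +kernel

/-- For four distinct marks the induced edge map is a bijection. -/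
lemma sigmaOf_bij : ∀ s y o u : Fin 5, s ≠ y → s ≠ o → s ≠ u → y ≠ o → y ≠ u → o ≠ u →
    Function.Bijective (sigmaOf (permOf s y o u)) := by
  decide +kernel

/-- The induced edge map is compatible with the vertex map on `k5`. -/
lemma sigmaOf_comp : ∀ s y o u : Fin 5, s ≠ y → s ≠ o → s ≠ u → y ≠ o → y ≠ u → o ≠ u →
    ∀ e, k5 (sigmaOf (permOf s y o u) e) = Sym2.map (permOf s y o u) (k5 e) := by
  decide +kernel

section Main

variable {R : Type*} [CommRing R] [LinearOrder R] [IsStrictOrderedRing R]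

/-- **(XW) on `K₅` for every admissible weight vector and every placement of four distinct
marks** — hence on every loop-free multigraph on five vertices. -/
theorem xw_k5 (p : Fin 10 → R) (hp : IsProbVec p) (s y o u : Fin 5) (hsy : s ≠ y)
    (hso : s ≠ o) (hsu : s ≠ u) (hyo : y ≠ o) (hyu : y ≠ u) (hou : o ≠ u) :
    0 ≤ xwBil k5 s y o u p p := by
  let φe : Fin 5 ≃ Fin 5 := Equiv.ofBijective _ (permOf_bij s y o u hsy hso hsu hyo hyu hou)
  let σe : Fin 10 ≃ Fin 10 :=
    Equiv.ofBijective _ (sigmaOf_bij s y o u hsy hso hsu hyo hyu hou)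
  have hcomp : ∀ e, k5 (σe e) = Sym2.map φe (k5 e) :=
    sigmaOf_comp s y o u hsy hso hsu hyo hyu hou
  have h := XWRelabel.xwBil_relabel (ends := k5) σe φe hcomp p 0 1 2 3
  have h0 : φe 0 = s := rfl
  have h1 : φe 1 = y := rfl
  have h2 : φe 2 = o := rfl
  have h3 : φe 3 = u := rfl
  rw [h0, h1, h2, h3] at h
  rw [h]
  exact xw_k5_base (p ∘ σe) (XWRelabel.isProbVec_comp hp σe)

end Main

end XWKFive

end Summit.Ventures.PercRepro2
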